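import Summits.ValiantsHypothesis.ValiantsHypothesis.Theorems.GeneratorObstructionsPerGenDegreeSuperQPAtomCertificates
import Literature.Computability.AlgebraicComplexity.BI17DetPerMinimalDegreeProofs
import Literature.Computability.AlgebraicComplexity.BI17OddPlethysmColumnSets
import Literature.Computability.AlgebraicComplexity.PolystabilityProofs
import Literature.Computability.AlgebraicComplexity.OrbitClosureInheritance
import Literature.NumberTheory.DiophantineGeometry.SchurWeylPlethysmCoordRepWeightsProofs
import Literature.Computability.Complexity.OccurrenceObstructionsIP

/-!
# Route GeneratorObstructions — K1 `PerGenDegreeSuperQP` (stmt-ValiantsHypothesis-11654),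
# line `per-side-atoms`: the FIRST RECTANGULAR ATOM, and `stub_atomLate` for `c ≤ 1`

Companion of `GeneratorObstructionsPerGenDegreeSuperQPAtomCertificates.lean` (atom certificates).
The registered stub `stub_atomLate` asks, for every `c, m₀`, for `m ≥ m₀` and a weight `χ` OCCURRING
in `ℂ[Δ_m[per_m]]` which is an ATOM of the occurrence monoid, of degree
`-|χ|/m > 2^((log₂ m + c)^c)`. This file PROVES the instances `c ∈ {0, 1}` (the polynomial regime
of the degree clause) and isolates the honest remaining content (`c ≥ 2`, super-quasi-polynomial):

1. (`Fin N` model) an `SL_N`-invariant form `F` of degree `d` on `Sym^D ℂ^N` with `F(p) ≠ 0` forces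
   `N ∣ D d` (roots of unity, BI 2017 Lemma 3.2(2)) and is a highest-weight vector of the CONSTANT
   weight `-(Dd/N)·𝟙` (BI 2017 Rem. 3.13, tree `slInvariantsOfDegree_le_highestWeightSpace`), whose
   class in `ℂ[Δ_D[p]]` is nonzero: `hasHighestWeight_const_of_isSLInvariantCoord`; for POLYSTABLE
   `p ≠ 0` such an `F` exists (Hilbert–Mumford / Mumford–Fogarty–Kirwan, tree
   `exists_isSLInvariantCoord_aeval_formCoeff_ne_zero`): `exists_hasHighestWeight_const_of_isPolystable`.
2. `per_m` is polystable (BI 2017 Cor. 2.9, tree `BurgisserIkenmeyer2017_polystable_det_per_holds`);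
   transporting occurrence along the placement `Fin (m·m) → MatIdx m` (tree
   `hasHighestWeight_orbitCoordRep_rename_dualOfPartition_iff`, the constant weight being the dual
   of the `m² × k` rectangle) gives an occurring constant weight `-k·𝟙`, `k ≥ 1`, of
   `ℂ[Δ_m[per_m]]` in the stub's own coordinates (`per_exists_hasHighestWeight_const`).
3. `per_exists_least_const_atom`: the LEAST such `k₀` gives an ATOM — a splitting into two nonzero
   occurring weights has dominant summands summing to a constant, hence constant summands
   `-k₁·𝟙 + -k₂·𝟙`, `kᵢ ≥ 1`, contradicting minimality — and `m ≤ k₀` because the `m²` nonzero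
   entries of `-k₀·𝟙` are at most its degree `k₀ m` (companion file, `ℓ ≤ deg`). So `S(per_m)` has
   an atom of degree `≥ m²` for every `m ≥ 1` (`per_exists_atom_sq_le_degree`).
4. `stub_atomLate_of_le_one`: since `2^((log₂ m + c)^c) < m²` for `c ≤ 1`, `m ≥ 3`, the stub holds
   VERBATIM with the extra hypothesis `c ≤ 1`.

What is NOT here: any lower bound on atom degrees beyond `k₀ m` with `k₀ ≥ m` (BI 2017 §3.3 gives
`e(per_m) ≥ m²`, i.e. the same bound, with equality iff `P_{m,m²}(per_m) ≠ 0`); for `c ≥ 2` the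
degree clause needs atoms of degree `> 2^((log₂ m + 2)²) ≥ 16 m⁴`, beyond every certificate in the
tree. `stub_atomLate`, K1 and `GenFlipThesis` remain OPEN; nothing here bears on VP versus VNP.

References: [BurgisserIkenmeyer2017] Lemma 3.2, Rem. 3.13, Cor. 2.9, §3.3;
[MumfordFogartyKirwan1994] Ch. 2 §1; [BurgisserEtAl2011] Prop. 6.3.2 (placement / inheritance).
-/

set_option linter.dupNamespace false

noncomputable section

namespace Summit.ValiantsHypothesis.ValiantsHypothesis.Theorems.GeneratorObstructions.PerGenDegreeSuperQP

open MvPolynomial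
open Literature.NumberTheory.DiophantineGeometry Literature.Computability.AlgebraicComplexity
  Literature.Computability.Complexity

/-! ### 1. `SL_N`-invariants give occurring CONSTANT weights (model `Fin N`) -/

section FinModel

variable {N D : ℕ}

/-- Values of a homogeneous polynomial at a rescaled point: `F(c • x) = c^d · F(x)`. [folklore] -/
theorem aeval_smul_pt_of_isHomogeneous' {ι : Type*} {F : MvPolynomial ι ℂ} {d : ℕ}
    (hF : F.IsHomogeneous d) (c : ℂ) (x : ι → ℂ) : aeval (c • x) F = c ^ d * aeval x F := by
  classical
  rw [F.as_sum, map_sum, map_sum, Finset.mul_sum]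
  refine Finset.sum_congr rfl fun s hs => ?_
  simp only [aeval_monomial, Pi.smul_apply, smul_eq_mul, mul_pow, Finsupp.prod,
    Finset.prod_mul_distrib]
  rw [Finset.prod_pow_eq_pow_sum, ← hF.degree_eq_sum_deg_support hs]
  ring

/-- **`N ∣ D·d`** for an `SL_N`-invariant form `F` of degree `d` on `Sym^D ℂ^N` not vanishing at a
form `p` of degree `D`: the scalar `ζ · 1` (`ζ` a primitive `N`-th root of unity) lies in `SL_N`
and rescales `p` by `ζ^D`, so `F(p) = ζ^{D d} F(p)`. (BI 2017 Lemma 3.2(2), proof; the tree's copy is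
private.) [cite: BurgisserIkenmeyer2017, Lemma 3.2 (2) (proof)] -/
theorem dvd_mul_of_isSLInvariantCoord_of_aeval_ne_zero (hN : 0 < N) {p : MvPolynomial (Fin N) ℂ}
    (hp : p.IsHomogeneous D) {F : MvPolynomial (DegIdx (Fin N) D) ℂ} {d : ℕ}
    (hFd : F.IsHomogeneous d) (hFi : IsSLInvariantCoord D F) (hne : aeval (formCoeff D p) F ≠ 0) :
    N ∣ D * d := by
  have hζ := Complex.isPrimitiveRoot_exp N hN.ne'
  set ζ : ℂ := Complex.exp (2 * Real.pi * Complex.I / N) with hζdef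
  have hdetZ : Matrix.det (ζ • (1 : Matrix (Fin N) (Fin N) ℂ)) = 1 := by
    rw [Matrix.det_smul, Matrix.det_one, mul_one, Fintype.card_fin, hζ.pow_eq_one]
  have h1 := hFi.aeval_formCoeff_linSubst ⟨ζ • (1 : Matrix (Fin N) (Fin N) ℂ), hdetZ⟩ p
  rw [show ((⟨ζ • (1 : Matrix (Fin N) (Fin N) ℂ), hdetZ⟩ : Matrix.SpecialLinearGroup (Fin N) ℂ) :
      Matrix (Fin N) (Fin N) ℂ) = ζ • (1 : Matrix (Fin N) (Fin N) ℂ) from rfl,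
    linSubst_smul_of_isHomogeneous hp, linSubst_one, AlgHom.id_apply, formCoeff_smul,
    aeval_smul_pt_of_isHomogeneous' hFd, ← pow_mul] at h1
  have h2 : ζ ^ (D * d) = 1 := mul_right_cancel₀ hne (h1.trans (one_mul _).symm)
  exact (hζ.pow_eq_one_iff_dvd _).mp h2

/-- **An `SL_N`-invariant not vanishing at `p` is a nonzero highest-weight vector of CONSTANT weight
in `ℂ[Δ_D[p]]`**: a homogeneous `SL_N`-invariant `F` of degree `d` with `F(p) ≠ 0` (`D ≠ 0`) lies
in `HWV_{(-(Dd/N))^N}(ℂ[Sym^D])` (BI 2017 Rem. 3.13, the tree's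
`slInvariantsOfDegree_le_highestWeightSpace`) and outside `I(GL · p)`, so its class is a nonzero
highest-weight vector of `ℂ[Δ_D[p]]` of the constant weight `-(Dd/N)`.
[cite: BurgisserIkenmeyer2017, Rem. 3.13] -/
theorem hasHighestWeight_const_of_isSLInvariantCoord (hN : 0 < N) {p : MvPolynomial (Fin N) ℂ}
    (hp : p.IsHomogeneous D) {F : MvPolynomial (DegIdx (Fin N) D) ℂ} {d : ℕ}
    (hFd : F.IsHomogeneous d) (hFi : IsSLInvariantCoord D F) (hne : aeval (formCoeff D p) F ≠ 0) :
    HasHighestWeight (orbitCoordRep p D) (fun _ : Fin N => -((D * d / N : ℕ) : ℤ)) := by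
  have hdvd := dvd_mul_of_isSLInvariantCoord_of_aeval_ne_zero hN hp hFd hFi hne
  have hF : F ∈ slInvariantsOfDegree (Fin N) ℂ D d :=
    (mem_slInvariantsOfDegree_iff D d F).mpr ⟨hFd, hFi⟩
  have hHW := slInvariantsOfDegree_le_highestWeightSpace hN hdvd hF
  have hFI : F ∉ orbitVanishingIdeal p D := by
    intro hmem
    have := mem_orbitVanishingIdeal_iff.1 hmem 1
    rw [map_one, Module.End.one_apply] at this
    exact hne this
  rw [hasHighestWeight_iff_exists]
  refine ⟨Ideal.Quotient.mk _ F, ?_, mk_mem_highestWeightSpace_orbitCoordRep p hHW⟩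
  rwa [Ne, Ideal.Quotient.eq_zero_iff_mem]

/-- **Polystable forms have occurring constant weights** (`Fin N` model, `N ≥ 1`, `D ≠ 0`): for a
polystable form `p ≠ 0` of degree `D` some constant weight `-k·𝟙`, `k ≥ 1`, occurs in
`ℂ[Δ_D[p]]` — Hilbert's non-vanishing invariant at a closed `SL`-orbit (the tree's
`exists_isSLInvariantCoord_aeval_formCoeff_ne_zero`, Mumford–Fogarty–Kirwan Ch. 2 §1), read as a
highest-weight vector. [cite: BurgisserIkenmeyer2017, Def. 3.3 (E(w) ≠ {0} for polystable w)] -/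
theorem exists_hasHighestWeight_const_of_isPolystable (hN : 0 < N) (hD : D ≠ 0)
    {p : MvPolynomial (Fin N) ℂ} (hp : p.IsHomogeneous D) (hp0 : p ≠ 0) (hps : IsPolystable p) :
    ∃ k : ℕ, 0 < k ∧ HasHighestWeight (orbitCoordRep p D) (fun _ : Fin N => -(k : ℤ)) := by
  obtain ⟨F, d, hd, hFd, hFi, hFw⟩ := exists_isSLInvariantCoord_aeval_formCoeff_ne_zero hN hp hp0 hps
  refine ⟨D * d / N, ?_, hasHighestWeight_const_of_isSLInvariantCoord hN hp hFd hFi hFw⟩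
  obtain ⟨q, hq⟩ := dvd_mul_of_isSLInvariantCoord_of_aeval_ne_zero hN hp hFd hFi hFw
  rw [hq, Nat.mul_div_cancel_left _ hN]
  rcases Nat.eq_zero_or_pos q with h0 | h0
  · exfalso
    rw [h0, mul_zero] at hq
    exact (Nat.mul_ne_zero hD hd.ne') hq
  · exact h0

end FinModel

/-! ### 2. The permanent: an occurring constant weight, and the LEAST one is an atom of degree `≥ m²` -/

section Permanent

variable {m : ℕ}

/-- `per_m` numbered by `Fin (m·m)` and then placed lexicographically is `per_m` in the
lexicographic matrix variables. [folklore] -/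
theorem rename_perFin_eq (m : ℕ) :
    rename (fun i : Fin (m * m) => (toLex (finProdFinEquiv.symm i) : MatIdx m))
        (rename (finProdFinEquiv : Fin m × Fin m ≃ Fin (m * m)) (perPoly (Fin m) ℂ)) =
      rename (toLex : Fin m × Fin m → MatIdx m) (perPoly (Fin m) ℂ) := by
  have h : ((fun i : Fin (m * m) => (toLex (finProdFinEquiv.symm i) : MatIdx m)) ∘
      (finProdFinEquiv : Fin m × Fin m ≃ Fin (m * m)) : Fin m × Fin m → MatIdx m) = toLex := by
    funext ij
    simp only [Function.comp_apply, Equiv.symm_apply_apply]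
  rw [rename_rename, h]

/-- The dual weight of the `N × k` rectangle on `N` letters is the constant weight `-k`. [folklore] -/
theorem dualOfPartition_rectangle_self (N k : ℕ) :
    Weight.dualOfPartition N (Nat.Partition.rectangle N k) = fun _ : Fin N => -(k : ℤ) := by
  funext i
  show -(Weight.ofPartition N (Nat.Partition.rectangle N k) (Fin.rev i)) = -(k : ℤ)
  rw [ofPartition_rectangle]
  dsimp only
  rw [if_pos (Fin.rev i).is_lt]

/-- **`per_m` has occurring constant weights** (`m ≥ 1`): some `-k·𝟙`, `k ≥ 1`, occurs in
`ℂ[Δ_m[per_m]]` (lexicographic matrix variables) — `per_m` is polystable (BI 2017 Cor. 2.9, tree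
`BurgisserIkenmeyer2017_polystable_det_per_holds`), §1 in the `Fin (m·m)` numbering, and transport
of occurrence along the placement `Fin (m·m) → MatIdx m` (tree
`hasHighestWeight_orbitCoordRep_rename_dualOfPartition_iff`, the constant weight being the dual of
the `m² × k` rectangle). [cite: BurgisserIkenmeyer2017, Cor. 2.9] -/
theorem per_exists_hasHighestWeight_const (hm : 1 ≤ m) :
    ∃ k : ℕ, 0 < k ∧ HasHighestWeight (orbitCoordRep (rename toLex (perPoly (Fin m) ℂ)) m)
      (fun _ : MatIdx m => -(k : ℤ)) := by
  classical
  set e : Fin m × Fin m ≃ Fin (m * m) := finProdFinEquiv with he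
  set p : MvPolynomial (Fin (m * m)) ℂ := rename e (perPoly (Fin m) ℂ) with hpdef
  have hp : p.IsHomogeneous m := by
    simpa [Fintype.card_fin] using
      (perPoly_isHomogeneous (n := Fin m) (k := ℂ)).rename_isHomogeneous (f := e)
  have hp0 : p ≠ 0 := by
    intro h
    have hinj := rename_injective (R := ℂ) (e : Fin m × Fin m → Fin (m * m)) e.injective
    have h0 : perPoly (Fin m) ℂ = 0 := hinj (by rw [← hpdef, h, map_zero])
    exact perFormLex_ne_zero m (by rw [h0, map_zero])
  have hps : IsPolystable p := ((BurgisserIkenmeyer2017_polystable_det_per_holds m).2).rename_equiv e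
  have hN : 0 < m * m := Nat.mul_pos hm hm
  obtain ⟨k, hk, hHW⟩ := exists_hasHighestWeight_const_of_isPolystable hN (by omega) hp hp0 hps
  refine ⟨k, hk, ?_⟩
  set κ : Fin (m * m) → MatIdx m := fun i => toLex (e.symm i) with hκ
  have hκinj : Function.Injective κ := fun i j hij => e.symm.injective (toLex.injective hij)
  have key := hasHighestWeight_orbitCoordRep_rename_dualOfPartition_iff (k := ℂ) (m := m)
    (matIdxEquiv m) κ hκinj p (by omega) (Nat.Partition.rectangle (m * m) k)
    (Nat.Partition.card_parts_rectangle_le (m * m) k)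
  rw [dualOfPartition_rectangle_self, hκ, hpdef, he, rename_perFin_eq m] at key
  exact key.mpr hHW

/-- **Two dominant weights summing to a constant weight are constant** (on a linear order): `χ` is
antitone and `c - χ = ψ` is antitone, so `χ` is also monotone. [folklore] -/
theorem apply_eq_apply_of_isDominant_add_eq_const {σ : Type*} [LinearOrder σ] {χ ψ : Weight σ}
    (hχ : χ.IsDominant) (hψ : ψ.IsDominant) {c : ℤ} (h : χ + ψ = fun _ => c) (i j : σ) :
    χ i = χ j := by
  have hij : ∀ a b : σ, a ≤ b → χ a = χ b := by
    intro a b hab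
    have h1 : χ b ≤ χ a := hχ hab
    have h2 : ψ b ≤ ψ a := hψ hab
    have ha := congrFun h a
    have hb := congrFun h b
    simp only [Pi.add_apply] at ha hb
    omega
  rcases le_total i j with hle | hle
  · exact hij i j hle
  · exact (hij j i hle).symm

/-- **The least occurring constant weight of `per_m` is an ATOM of degree `≥ m²`.** For `1 ≤ m`
there is `k₀ ≥ 1` such that `-k₀·𝟙` OCCURS in `ℂ[Δ_m[per_m]]`, no `-k·𝟙` with `0 < k < k₀` occurs,
`-k₀·𝟙` is an ATOM of the occurrence monoid (a splitting into two nonzero occurring weights has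
dominant, hence CONSTANT, summands `-k₁·𝟙, -k₂·𝟙` with `k₁ + k₂ = k₀`, `kᵢ ≥ 1`, contradicting
minimality), and `m ≤ k₀` (its `m²` nonzero entries are at most its degree `k₀ m`, by
`card_filter_ne_zero_le_degree`) — an atom of degree `k₀ · m ≥ m²`. (BI 2017 §3.3 proves the
sharper `e(per_m) ≥ m²` with equality iff `P_{m,m²}(per_m) ≠ 0`; not needed here.)
[cite: BurgisserIkenmeyer2017, §3.3 (before Rem. 3.27)] -/
theorem per_exists_least_const_atom (hm : 1 ≤ m) :
    ∃ k₀ : ℕ, 0 < k₀ ∧ m ≤ k₀ ∧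
      highestWeightSpace (orbitCoordRep (rename toLex (perPoly (Fin m) ℂ)) m)
          (fun _ : MatIdx m => -(k₀ : ℤ)) ≠ ⊥ ∧
      (∀ k : ℕ, 0 < k → k < k₀ →
        highestWeightSpace (orbitCoordRep (rename toLex (perPoly (Fin m) ℂ)) m)
          (fun _ : MatIdx m => -(k : ℤ)) = ⊥) ∧
      (∀ χ₁ χ₂ : Weight (MatIdx m), χ₁ + χ₂ = (fun _ : MatIdx m => -(k₀ : ℤ)) → χ₁ ≠ 0 → χ₂ ≠ 0 →
        highestWeightSpace (orbitCoordRep (rename toLex (perPoly (Fin m) ℂ)) m) χ₁ = ⊥ ∨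
          highestWeightSpace (orbitCoordRep (rename toLex (perPoly (Fin m) ℂ)) m) χ₂ = ⊥) := by
  classical
  haveI : Infinite ℂ := CharZero.infinite ℂ
  haveI : NeZero m := ⟨by omega⟩
  have hex := per_exists_hasHighestWeight_const hm
  set k₀ := Nat.find hex with hk₀
  obtain ⟨hk₀pos, hocc⟩ := Nat.find_spec hex
  have hmin : ∀ k : ℕ, 0 < k → k < k₀ →
      highestWeightSpace (orbitCoordRep (rename toLex (perPoly (Fin m) ℂ)) m)
        (fun _ : MatIdx m => -(k : ℤ)) = ⊥ := by
    intro k hk hlt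
    by_contra hne
    exact Nat.find_min hex hlt ⟨hk, hne⟩
  have hocc' : highestWeightSpace (orbitCoordRep (rename toLex (perPoly (Fin m) ℂ)) m)
      (fun _ : MatIdx m => -(k₀ : ℤ)) ≠ ⊥ := hocc
  refine ⟨k₀, hk₀pos, ?_, hocc', hmin, ?_⟩
  · -- `m ≤ k₀`: all `m²` entries are nonzero, and `ℓ ≤ degree = k₀ m`
    have hsize : Weight.size (fun _ : MatIdx m => -(k₀ : ℤ)) = -((m * (k₀ * m) : ℕ) : ℤ) := by
      rw [Weight.size, Finset.sum_const, Finset.card_univ, Fintype.card_lex, Fintype.card_prod,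
        Fintype.card_fin, nsmul_eq_mul]
      push_cast
      ring
    have hℓ := card_filter_ne_zero_le_degree (rename toLex (perPoly (Fin m) ℂ)) (by omega)
      (perFormLex_isHomogeneous m) hocc' hsize
    have hcard : (Finset.univ.filter fun x : MatIdx m => (fun _ : MatIdx m => -(k₀ : ℤ)) x ≠ 0).card
        = m * m := by
      rw [Finset.filter_true_of_mem fun x _ => ?_, Finset.card_univ, Fintype.card_lex,
        Fintype.card_prod, Fintype.card_fin]
      simp only [ne_eq, neg_eq_zero, Nat.cast_eq_zero]
      exact hk₀pos.ne'
    rw [hcard] at hℓ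
    exact Nat.le_of_mul_le_mul_right hℓ hm
  · intro χ₁ χ₂ hsum h1 h2
    by_contra hne
    rw [not_or] at hne
    obtain ⟨hne1, hne2⟩ := hne
    have h1' : HasHighestWeight (orbitCoordRep (rename toLex (perPoly (Fin m) ℂ)) m) χ₁ := hne1
    have h2' : HasHighestWeight (orbitCoordRep (rename toLex (perPoly (Fin m) ℂ)) m) χ₂ := hne2
    obtain ⟨hle1, -⟩ := nonpos_and_exists_size_eq_of_hasHighestWeight_orbitCoordRep _ h1'
    obtain ⟨hle2, -⟩ := nonpos_and_exists_size_eq_of_hasHighestWeight_orbitCoordRep _ h2'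
    have hdom1 := isDominant_of_hasHighestWeight_orbitCoordRep _ h1'
    have hdom2 := isDominant_of_hasHighestWeight_orbitCoordRep _ h2'
    -- both summands are constant
    have hc1 := apply_eq_apply_of_isDominant_add_eq_const hdom1 hdom2 hsum
    have hc2 := apply_eq_apply_of_isDominant_add_eq_const hdom2 hdom1
      (by rw [add_comm]; exact hsum)
    set t := topMatIdx m with ht
    -- the constants `c₁ = χ₁ t`, `c₂ = χ₂ t`: nonpositive, nonzero, summing to `-k₀`
    have hχ1 : χ₁ = fun _ => χ₁ t := funext fun x => hc1 x t
    have hχ2 : χ₂ = fun _ => χ₂ t := funext fun x => hc2 x t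
    have hc1ne : χ₁ t ≠ 0 := fun h0 => h1 (by rw [hχ1, h0]; rfl)
    have hc2ne : χ₂ t ≠ 0 := fun h0 => h2 (by rw [hχ2, h0]; rfl)
    have hst := congrFun hsum t
    simp only [Pi.add_apply] at hst
    have hc1le := hle1 t
    have hc2le := hle2 t
    -- `k₁ := -χ₁ t` is a positive natural number `< k₀` whose constant weight occurs
    obtain ⟨k₁, hk₁⟩ : ∃ k₁ : ℕ, χ₁ t = -(k₁ : ℤ) := ⟨(-χ₁ t).toNat, by omega⟩
    have hk₁pos : 0 < k₁ := by omega
    have hk₁lt : k₁ < k₀ := by omega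
    apply hne1
    rw [hχ1, hk₁]
    exact hmin k₁ hk₁pos hk₁lt

/-- **Atoms of degree at least `m²`** (in the vocabulary of `stub_atomLate`): for every `m ≥ 1` the
occurrence monoid of `ℂ[Δ_m[per_m]]` has an occurring ATOM `χ` with `-|χ| ≥ m · m²`, i.e. of
degree `-|χ|/m ≥ m²` — the least occurring constant weight. [cite: BurgisserIkenmeyer2017, §3.3] -/
theorem per_exists_atom_sq_le_degree (hm : 1 ≤ m) :
    ∃ χ : Weight (MatIdx m),
      highestWeightSpace (orbitCoordRep (MvPolynomial.rename toLex (perPoly (Fin m) ℂ)) m) χ ≠ ⊥ ∧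
      (∀ χ₁ χ₂ : Weight (MatIdx m), χ₁ + χ₂ = χ → χ₁ ≠ 0 → χ₂ ≠ 0 →
          highestWeightSpace (orbitCoordRep (MvPolynomial.rename toLex (perPoly (Fin m) ℂ)) m) χ₁ = ⊥ ∨
            highestWeightSpace (orbitCoordRep (MvPolynomial.rename toLex (perPoly (Fin m) ℂ)) m) χ₂ = ⊥) ∧
      (m : ℤ) * (m * m : ℕ) ≤ -(Weight.size χ) := by
  obtain ⟨k₀, hk₀, hmk, hocc, -, hatom⟩ := per_exists_least_const_atom hm
  refine ⟨fun _ => -(k₀ : ℤ), hocc, hatom, ?_⟩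
  rw [Weight.size, Finset.sum_const, Finset.card_univ, Fintype.card_lex, Fintype.card_prod,
    Fintype.card_fin, nsmul_eq_mul]
  push_cast
  have : (m : ℤ) ≤ k₀ := by exact_mod_cast hmk
  have hm0 : (0 : ℤ) ≤ m := by positivity
  nlinarith

/-! ### 3. `stub_atomLate` in the polynomial regime `c ≤ 1` -/

/-- Arithmetic of the degree clause for `c ≤ 1`: `2^((log₂ m + c)^c) < m²` once `m ≥ 3`
(`c = 0`: `2 < m²`; `c = 1`: `2^(log₂ m + 1) ≤ 2m < m²`). [folklore] -/
theorem two_pow_log_add_pow_lt_sq {c m : ℕ} (hc : c ≤ 1) (hm : 3 ≤ m) :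
    2 ^ ((Nat.log 2 m + c) ^ c) < m * m := by
  interval_cases c
  · simp only [add_zero, pow_zero, pow_one]
    nlinarith
  · rw [pow_one, pow_succ]
    have h1 : 2 ^ Nat.log 2 m ≤ m := Nat.pow_log_le_self 2 (by omega)
    nlinarith

/-- **`stub_atomLate` holds for `c ≤ 1`** (the polynomial regime of the degree clause): for
`c ∈ {0, 1}` and every `m₀` there is `m ≥ max(m₀, 3)` and an occurring ATOM `χ` of `ℂ[Δ_m[per_m]]`
with `m · 2^((log₂ m + c)^c) < -|χ|` — the least occurring constant weight, of degree `≥ m²`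
(`per_exists_atom_sq_le_degree`), and `2^((log₂ m + c)^c) < m²` for `c ≤ 1`, `m ≥ 3`. The
super-quasi-polynomial regime `c ≥ 2` — the content of `stub_atomLate` — is NOT touched: both atom
certificates of the companion file and the constant-weight atoms here live at degree `O(m²)`…`k₀m`
with no lower bound on `k₀` beyond `m` in the tree. [cite: BurgisserIkenmeyer2017, §3.3] -/
theorem stub_atomLate_of_le_one :
    ∀ c m₀ : ℕ, c ≤ 1 → ∃ m : ℕ, m₀ ≤ m ∧ 1 ≤ m ∧ ∃ χ : Weight (MatIdx m),
      highestWeightSpace (orbitCoordRep (MvPolynomial.rename toLex (perPoly (Fin m) ℂ)) m) χ ≠ ⊥ ∧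
      (∀ χ₁ χ₂ : Weight (MatIdx m), χ₁ + χ₂ = χ → χ₁ ≠ 0 → χ₂ ≠ 0 →
          highestWeightSpace (orbitCoordRep (MvPolynomial.rename toLex (perPoly (Fin m) ℂ)) m) χ₁ = ⊥ ∨
            highestWeightSpace (orbitCoordRep (MvPolynomial.rename toLex (perPoly (Fin m) ℂ)) m) χ₂ = ⊥) ∧
      (m : ℤ) * 2 ^ ((Nat.log 2 m + c) ^ c) < -(Weight.size χ) := by
  intro c m₀ hc
  refine ⟨max m₀ 3, le_max_left _ _, le_trans (by norm_num) (le_max_right _ _), ?_⟩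
  set m := max m₀ 3 with hmdef
  have hm3 : 3 ≤ m := le_max_right _ _
  obtain ⟨χ, hocc, hatom, hdeg⟩ := per_exists_atom_sq_le_degree (m := m) (by omega)
  refine ⟨χ, hocc, hatom, lt_of_lt_of_le ?_ hdeg⟩
  have hlt := two_pow_log_add_pow_lt_sq hc hm3
  have hm0 : (0 : ℤ) < m := by positivity
  have : (2 : ℤ) ^ ((Nat.log 2 m + c) ^ c) < ((m * m : ℕ) : ℤ) := by exact_mod_cast hlt
  exact mul_lt_mul_of_pos_left this hm0

end Permanent

end Summit.ValiantsHypothesis.ValiantsHypothesis.Theorems.GeneratorObstructions.PerGenDegreeSuperQP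

end
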